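import Mathlib
import HarnessLib
import Literature.MathematicalPhysics.QuantumLattice.HubbardBandSectorCountingBounds

/-!
# Route `KLProgramme` (cruxes K1/K3): the `[tree]` constant bundle `bandBounds a b` of the band Fermi
# curve in CLOSED FORM — degradation laws toward the van Hove level and the band bottom

Cell `gate-hubbard-kl`, risk-register item r2 («the window constants are fs-1's», DECOMP v7 §3″). Every
Lean consumer of the free Fermi curve in the programme (the four-sector count `stub_fourSectorCount` /
`klsc_fourSectorCount_thickShell`, p1b's App. E chain `KLProgrammeKLRegimeTwoPointLimitShell*`, F.1
`CountPairsOffset`) carries its constants as the fields of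
`Literature.MathematicalPhysics.QuantumLattice.BandSectorCounting.bandBounds ha hab hb : BandBounds a b`
on a level range `[a, b] ⊂ (-4, 0)`: `umin = √(a+4)`, `smax = U₁ + 5`, `A2 = U₂ + 2U₁ + 6`,
`hmin = h₀/cmax²`, `amin = hmin/(cmax (25 + U₁²))`, `rhomin = q_b umin`, `cmax = 2/umin`,
`Dtmin = 2 q_b umin`, with `q_b = sin K_b / K_b`, `U₁ = 2K_b / sin K_b`, `K_b = arccos(-b/2 - 1)`
(`HubbardBandSectorCountingBounds.lean`). E1-NOTE §4 (p1b): «on the programme window it is a fixed number,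
to be evaluated once from the `[tree]` formulas `cHmin, cAmin, cCmax, cU1, cQ`».

This file makes that evaluation a matter of `norm_num`: the one transcendental quantity is `K_b`, and
`sin K_b = √(-b(4+b))/2` is ALGEBRAIC (`klfs_sin_umklappRadius`), so with `K_b < π` every constant has an
explicit algebraic bound in `(a, b, π)` in the direction the consumers need (lower bounds for
`q_b, hmin, amin, rhomin, Dtmin`, upper bounds for `U₁, smax, A2, C_g, D_cell`):

* `klfs_cHmin_eq` — `hmin = (-b)(16 - a²)(a + 4)/128` EXACTLY (no transcendental part): linear
  degradation `∝ |b|` toward the van Hove level `b ↑ 0`, `∝ (a+4)` toward the band bottom;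
* `klfs_cQ_ge` — `q_b ≥ √(-b(4+b))/(2π)`; `klfs_cU1_le` — `U₁ ≤ 4π/√(-b(4+b))`;
  `klfs_cSmax_le`, `klfs_cRhomin_ge`, `klfs_cDtmin_ge`, `klfs_cAmin_ge`, `klfs_cA2_le`;
* `klfs_bandBounds_Cg_le` — the Gauss constant `C_g = π cmax/(2 amin rhomin²) ≤ π c_max/(2 A₀ R₀²)` with
  the closed forms `A₀ ≤ amin`, `R₀ ≤ rhomin` above: it blows up like `|b|⁻³` at the van Hove level (the
  count constants of `count_pairs_exists` are polynomial in `C_g`);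
* `klfs_bandBounds_Dcell_le` — the cell constant.

These are the honest sizes of the GENERIC bundle; the free curve's true geometry on the window is far
better (`KLProgrammeFermiSurfaceEnvelope/Window`: `v_F ≥ 0.8287`, `0.0317 ≤ κ ≤ 2.414` on
`μ ∈ [-0.4267, -0.1798]`) — a window-specific `BandBounds` instance built from those envelopes is the
upgrade path if explicit constants are ever wanted (risk r1). No definitions; everything PROVED. [folklore]
-/

noncomputable section

open Real Set

-- the tree's namespace `Summit.<Summit>.<Problem>.Theorems` repeats the summit name by design (D-0017)
set_option linter.dupNamespace false

namespace Summit.HubbardSuperconductivity.HubbardSuperconductivity.Theorems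

open Literature.MathematicalPhysics.QuantumLattice
open Literature.MathematicalPhysics.QuantumLattice.BandSectorCounting

/-! ### §1 The one transcendental quantity: `K_b`, with `sin K_b` algebraic -/

/-- **`sin K(b) = √(-b(4+b))/2`** for `-4 ≤ b ≤ 0` (`cos K = -b/2 - 1`, `K ∈ [0, π]`). [folklore] -/
theorem klfs_sin_umklappRadius {b : ℝ} (hb₁ : -4 ≤ b) (hb₂ : b ≤ 0) :
    Real.sin (umklappRadius b) = Real.sqrt (-b * (4 + b)) / 2 := by
  have hc : Real.cos (umklappRadius b) = -b / 2 - 1 := by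
    rw [umklappRadius, Real.cos_arccos (by linarith) (by linarith)]
  have hnn : 0 ≤ Real.sin (umklappRadius b) :=
    Real.sin_nonneg_of_nonneg_of_le_pi (umklappRadius_nonneg b) (by unfold umklappRadius; exact Real.arccos_le_pi _)
  have hs : 0 ≤ -b * (4 + b) := by nlinarith
  have hsq : Real.sin (umklappRadius b) ^ 2 = (Real.sqrt (-b * (4 + b)) / 2) ^ 2 := by
    rw [Real.sin_sq, hc, div_pow, Real.sq_sqrt hs]; ring
  exact (pow_left_inj₀ hnn (by positivity) two_ne_zero).1 hsq

/-- `0 < -b(4+b)` on the open band. [folklore] -/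
theorem klfs_levelProduct_pos {b : ℝ} (hb₁ : -4 < b) (hb₂ : b < 0) : 0 < -b * (4 + b) := by nlinarith

/-- **`q_b = sin K_b/K_b ≥ √(-b(4+b))/(2π)`** (`K_b < π`). [folklore] -/
theorem klfs_cQ_ge {b : ℝ} (hb₁ : -4 < b) (hb₂ : b < 0) :
    Real.sqrt (-b * (4 + b)) / (2 * π) ≤ cQ b := by
  unfold cQ
  rw [klfs_sin_umklappRadius hb₁.le hb₂.le, div_div]
  have hK := umklappRadius_pos hb₁
  have hKπ := umklappRadius_lt_pi hb₂
  exact div_le_div_of_nonneg_left (Real.sqrt_nonneg _) (by positivity) (by linarith)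

/-- `q_b ≤ √(-b(4+b))/π` for `-2 ≤ b < 0` (`K_b ≥ π/2`): the lower bound is sharp within a factor `2`.
[folklore] -/
theorem klfs_cQ_le {b : ℝ} (hb₁ : -2 ≤ b) (hb₂ : b < 0) :
    cQ b ≤ Real.sqrt (-b * (4 + b)) / π := by
  unfold cQ
  rw [klfs_sin_umklappRadius (by linarith) hb₂.le, div_div]
  have hK := pi_div_two_le_umklappRadius hb₁
  have hπ := Real.pi_pos
  calc Real.sqrt (-b * (4 + b)) / (2 * umklappRadius b)
      ≤ Real.sqrt (-b * (4 + b)) / (2 * (π / 2)) :=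
        div_le_div_of_nonneg_left (Real.sqrt_nonneg _) (by positivity) (by linarith)
    _ = Real.sqrt (-b * (4 + b)) / π := by ring

/-- **`U₁ = 2K_b/sin K_b ≤ 4π/√(-b(4+b))`**. [folklore] -/
theorem klfs_cU1_le {b : ℝ} (hb₁ : -4 < b) (hb₂ : b < 0) :
    cU1 b ≤ 4 * π / Real.sqrt (-b * (4 + b)) := by
  unfold cU1
  rw [klfs_sin_umklappRadius hb₁.le hb₂.le]
  have hs := Real.sqrt_pos.2 (klfs_levelProduct_pos hb₁ hb₂)
  have hK := umklappRadius_pos hb₁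
  have hKπ := umklappRadius_lt_pi hb₂
  rw [div_div_eq_mul_div, div_le_div_iff_of_pos_right hs]
  linarith

/-- `0 < U₁`-type positivity of the bound. [folklore] -/
theorem klfs_cU1_nonneg {b : ℝ} (hb₁ : -4 < b) (hb : b < 0) : 0 ≤ cU1 b :=
  (cU1_pos hb₁ le_rfl hb).le

/-- **`s_max = U₁ + 5 ≤ 4π/√(-b(4+b)) + 5`**. [folklore] -/
theorem klfs_cSmax_le {b : ℝ} (hb₁ : -4 < b) (hb₂ : b < 0) :
    cSmax b ≤ 4 * π / Real.sqrt (-b * (4 + b)) + 5 := by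
  unfold cSmax; linarith [klfs_cU1_le hb₁ hb₂]

/-- **`h_min = (-b)(16 - a²)(a + 4)/128` exactly** — the strict-convexity constant of the bundle is
algebraic: it degrades linearly in `|b|` toward the van Hove level and linearly in `a + 4` toward the band
bottom. [folklore] -/
theorem klfs_cHmin_eq {a : ℝ} (ha : -4 < a) (b : ℝ) :
    cHmin a b = -b * (16 - a ^ 2) * (a + 4) / 128 := by
  unfold cHmin cH0 cCmax cUmin
  have h4 : 0 < a + 4 := by linarith
  have hs : Real.sqrt (a + 4) ≠ 0 := (Real.sqrt_pos.2 h4).ne'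
  rw [div_pow, Real.sq_sqrt h4.le]
  field_simp
  ring

/-- **`ρ_min = q_b √(a+4) ≥ √(-b(4+b)) √(a+4)/(2π)`**. [folklore] -/
theorem klfs_cRhomin_ge {a b : ℝ} (hb₁ : -4 < b) (hb₂ : b < 0) :
    Real.sqrt (-b * (4 + b)) * Real.sqrt (a + 4) / (2 * π) ≤ cRhomin a b := by
  unfold cRhomin cUmin
  have h := mul_le_mul_of_nonneg_right (klfs_cQ_ge hb₁ hb₂) (Real.sqrt_nonneg (a + 4))
  calc Real.sqrt (-b * (4 + b)) * Real.sqrt (a + 4) / (2 * π)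
      = Real.sqrt (-b * (4 + b)) / (2 * π) * Real.sqrt (a + 4) := by ring
    _ ≤ cQ b * Real.sqrt (a + 4) := h

/-- **`Dt_min = 2 q_b √(a+4) ≥ √(-b(4+b)) √(a+4)/π`** (radial transversality). [folklore] -/
theorem klfs_cDtmin_ge {a b : ℝ} (hb₁ : -4 < b) (hb₂ : b < 0) :
    Real.sqrt (-b * (4 + b)) * Real.sqrt (a + 4) / π ≤ cDtmin a b := by
  unfold cDtmin
  have h := klfs_cRhomin_ge (a := a) hb₁ hb₂
  unfold cRhomin at h
  calc Real.sqrt (-b * (4 + b)) * Real.sqrt (a + 4) / π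
      = 2 * (Real.sqrt (-b * (4 + b)) * Real.sqrt (a + 4) / (2 * π)) := by ring
    _ ≤ 2 * (cQ b * cUmin a) := by linarith
    _ = 2 * cQ b * cUmin a := by ring

/-- **`a_min = h_min/(c_max (25 + U₁²)) ≥ h_min √(a+4) / (2 (25 + 16π²/(-b(4+b))))`** (Gauss-map rate).
[folklore] -/
theorem klfs_cAmin_ge {a b : ℝ} (ha : -4 < a) (hab : a ≤ b) (hb : b < 0) :
    cHmin a b * Real.sqrt (a + 4) / (2 * (25 + 16 * π ^ 2 / (-b * (4 + b)))) ≤ cAmin a b := by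
  have hb₁ : -4 < b := by linarith
  have hh := (cHmin_pos ha hab hb).le
  have hs := klfs_levelProduct_pos hb₁ hb
  have hsq := Real.sqrt_pos.2 hs
  have h4 := Real.sqrt_pos.2 (show 0 < a + 4 by linarith)
  have hU := klfs_cU1_le hb₁ hb
  have hU0 := klfs_cU1_nonneg hb₁ hb
  have hU2 : cU1 b ^ 2 ≤ 16 * π ^ 2 / (-b * (4 + b)) := by
    calc cU1 b ^ 2 ≤ (4 * π / Real.sqrt (-b * (4 + b))) ^ 2 := pow_le_pow_left₀ hU0 hU 2
      _ = 16 * π ^ 2 / (-b * (4 + b)) := by rw [div_pow, Real.sq_sqrt hs.le]; ring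
  unfold cAmin cCmax cUmin
  have e : cHmin a b / (2 / Real.sqrt (a + 4) * (25 + cU1 b ^ 2)) =
      cHmin a b * Real.sqrt (a + 4) / (2 * (25 + cU1 b ^ 2)) := by
    field_simp
  rw [e]
  exact div_le_div_of_nonneg_left (by positivity) (by positivity) (by linarith)

/-- **`A₂ = U₂ + 2U₁ + 6`** bounded with `U₁ ≤ V := 4π/√(-b(4+b))` and `1/q_b ≤ 2π/√(-b(4+b))`:
`A₂ ≤ (25 + 2V² + (V² + 25)·2π/√(-b(4+b)))/√(a+4) + 2V + 6`. [folklore] -/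
theorem klfs_cA2_le {a b : ℝ} (ha : -4 < a) (hb₁ : -4 < b) (hb₂ : b < 0) :
    cA2 a b ≤ (25 + 2 * (4 * π / Real.sqrt (-b * (4 + b))) ^ 2 +
        ((4 * π / Real.sqrt (-b * (4 + b))) ^ 2 + 25) * (2 * π / Real.sqrt (-b * (4 + b)))) /
          Real.sqrt (a + 4) + 2 * (4 * π / Real.sqrt (-b * (4 + b))) + 6 := by
  have hs := klfs_levelProduct_pos hb₁ hb₂
  have hsq := Real.sqrt_pos.2 hs
  have h4 := Real.sqrt_pos.2 (show 0 < a + 4 by linarith)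
  have hU := klfs_cU1_le hb₁ hb₂
  have hU0 := klfs_cU1_nonneg hb₁ hb₂
  have hq := klfs_cQ_ge hb₁ hb₂
  have hq0 := cQ_pos hb₁ le_rfl hb₂
  set V := 4 * π / Real.sqrt (-b * (4 + b)) with hV
  have hU2 : cU1 b ^ 2 ≤ V ^ 2 := pow_le_pow_left₀ hU0 hU 2
  have hinv : 1 / cQ b ≤ 2 * π / Real.sqrt (-b * (4 + b)) := by
    rw [div_le_div_iff₀ hq0 hsq]
    have := mul_le_mul_of_nonneg_left hq (show (0:ℝ) ≤ 2 * π by positivity)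
    have e : 2 * π * (Real.sqrt (-b * (4 + b)) / (2 * π)) = Real.sqrt (-b * (4 + b)) := by
      field_simp
    linarith [e]
  unfold cA2 cU2 cUmin
  have hnum : 25 + 2 * cU1 b ^ 2 + (cU1 b ^ 2 + 25) / cQ b ≤
      25 + 2 * V ^ 2 + (V ^ 2 + 25) * (2 * π / Real.sqrt (-b * (4 + b))) := by
    have h1 : (cU1 b ^ 2 + 25) / cQ b = (cU1 b ^ 2 + 25) * (1 / cQ b) := by ring
    rw [h1]
    have h2 : (cU1 b ^ 2 + 25) * (1 / cQ b) ≤ (V ^ 2 + 25) * (1 / cQ b) :=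
      mul_le_mul_of_nonneg_right (by linarith) (by positivity)
    have h3 : (V ^ 2 + 25) * (1 / cQ b) ≤ (V ^ 2 + 25) * (2 * π / Real.sqrt (-b * (4 + b))) :=
      mul_le_mul_of_nonneg_left hinv (by positivity)
    linarith
  have hdiv := div_le_div_of_nonneg_right hnum h4.le
  linarith

/-- **The Gauss constant `C_g = π c_max/(2 a_min ρ_min²)` of the bundle, in closed form**:
`C_g ≤ π c_max / (2 A₀ R₀²)` with `c_max = 2/√(a+4)`, `A₀ = h_min √(a+4)/(2(25 + 16π²/(-b(4+b))))`,
`R₀ = √(-b(4+b)) √(a+4)/(2π)` — polynomial blow-up `|b|⁻³` at the van Hove level (`h_min ∝ |b|`,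
`R₀² ∝ |b|`, `25 + 16π²/(-b(4+b)) ∝ |b|⁻¹`). [folklore] -/
theorem klfs_bandBounds_Cg_le {a b : ℝ} (ha : -4 < a) (hab : a ≤ b) (hb : b < 0) :
    (bandBounds ha hab hb).Cg ≤
      π * (2 / Real.sqrt (a + 4)) /
        (2 * (cHmin a b * Real.sqrt (a + 4) / (2 * (25 + 16 * π ^ 2 / (-b * (4 + b))))) *
          (Real.sqrt (-b * (4 + b)) * Real.sqrt (a + 4) / (2 * π)) ^ 2) := by
  have hb₁ : -4 < b := by linarith
  have hh := cHmin_pos ha hab hb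
  have hs := klfs_levelProduct_pos hb₁ hb
  have hsq := Real.sqrt_pos.2 hs
  have h4 := Real.sqrt_pos.2 (show 0 < a + 4 by linarith)
  have hA := klfs_cAmin_ge ha hab hb
  have hR := klfs_cRhomin_ge (a := a) hb₁ hb
  have hA0 : 0 < cHmin a b * Real.sqrt (a + 4) / (2 * (25 + 16 * π ^ 2 / (-b * (4 + b)))) := by positivity
  have hR0 : 0 < Real.sqrt (-b * (4 + b)) * Real.sqrt (a + 4) / (2 * π) := by positivity
  have hR2 : (Real.sqrt (-b * (4 + b)) * Real.sqrt (a + 4) / (2 * π)) ^ 2 ≤ cRhomin a b ^ 2 :=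
    pow_le_pow_left₀ hR0.le hR 2
  show π * cCmax a / (2 * cAmin a b * cRhomin a b ^ 2) ≤ _
  unfold cCmax cUmin
  refine div_le_div_of_nonneg_left (by positivity) (by positivity) ?_
  have := mul_le_mul hA hR2 (by positivity) (hA0.le.trans hA)
  linarith

/-- **The cell constant `D_cell = 1/Dt_min + s_max/2`** in closed form:
`D_cell ≤ π/(√(-b(4+b)) √(a+4)) + (4π/√(-b(4+b)) + 5)/2`. [folklore] -/
theorem klfs_bandBounds_Dcell_le {a b : ℝ} (ha : -4 < a) (hab : a ≤ b) (hb : b < 0) :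
    (bandBounds ha hab hb).Dcell ≤
      π / (Real.sqrt (-b * (4 + b)) * Real.sqrt (a + 4)) + (4 * π / Real.sqrt (-b * (4 + b)) + 5) / 2 := by
  have hb₁ : -4 < b := by linarith
  have hs := klfs_levelProduct_pos hb₁ hb
  have hsq := Real.sqrt_pos.2 hs
  have h4 := Real.sqrt_pos.2 (show 0 < a + 4 by linarith)
  have hD := klfs_cDtmin_ge (a := a) hb₁ hb
  have hS := klfs_cSmax_le hb₁ hb
  have hD0 : 0 < Real.sqrt (-b * (4 + b)) * Real.sqrt (a + 4) / π := by positivity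
  show 1 / cDtmin a b + cSmax b / 2 ≤ _
  have h1 : 1 / cDtmin a b ≤ 1 / (Real.sqrt (-b * (4 + b)) * Real.sqrt (a + 4) / π) :=
    div_le_div_of_nonneg_left zero_le_one hD0 hD
  have e : 1 / (Real.sqrt (-b * (4 + b)) * Real.sqrt (a + 4) / π) =
      π / (Real.sqrt (-b * (4 + b)) * Real.sqrt (a + 4)) := by
    field_simp
  rw [e] at h1
  linarith

/-! ### §2 The numbers on the sector-count range of the analysis window

`stub_fourSectorCount` / `klsc_fourSectorCount_thickShell` on `[μ₁, μ₂] = [-1, -0.15]` instantiate the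
bundle on `[a, b] = [(μ₁ - 4)/2, μ₂/2] = [-2.5, -0.075]`; there `-b(4+b) = 0.294375`, `a + 4 = 1.5`. -/

/-- `0.5425 ≤ √0.294375` and `1.2247 ≤ √1.5 ≤ 1.2248`, `√0.294375 ≤ 0.5426` (plumbing). [folklore] -/
theorem klfs_sqrt_bounds_analysisRange :
    (0.5425 : ℝ) ≤ Real.sqrt (-(-0.075 : ℝ) * (4 + (-0.075))) ∧ Real.sqrt (-(-0.075 : ℝ) * (4 + (-0.075))) ≤ 0.5426 ∧
    (1.2247 : ℝ) ≤ Real.sqrt ((-2.5 : ℝ) + 4) ∧ Real.sqrt ((-2.5 : ℝ) + 4) ≤ 1.2248 := by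
  refine ⟨?_, ?_, ?_, ?_⟩
  · exact Real.le_sqrt_of_sq_le (by norm_num)
  · exact Real.sqrt_le_iff.2 ⟨by norm_num, by norm_num⟩
  · exact Real.le_sqrt_of_sq_le (by norm_num)
  · exact Real.sqrt_le_iff.2 ⟨by norm_num, by norm_num⟩

/-- **On `[a, b] = [-2.5, -0.075]`** (the bundle of the four-sector count for the analysis window
`μ ∈ [-1, -0.15]`): `h_min = 0.075·9.75·1.5/128 ≥ 0.008568`, `q_b ≥ 0.0863`, `U₁ ≤ 23.17`,
`s_max ≤ 28.17`, `ρ_min ≥ 0.1057`, `Dt_min ≥ 0.2114`. [folklore] -/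
theorem klfs_analysisRange_constants :
    (0.008568 : ℝ) ≤ cHmin (-2.5) (-0.075) ∧ (0.0863 : ℝ) ≤ cQ (-0.075) ∧ cU1 (-0.075) ≤ 23.17 ∧
      cSmax (-0.075) ≤ 28.17 ∧ (0.1057 : ℝ) ≤ cRhomin (-2.5) (-0.075) ∧ (0.2114 : ℝ) ≤ cDtmin (-2.5) (-0.075) := by
  obtain ⟨hs1, hs2, h41, h42⟩ := klfs_sqrt_bounds_analysisRange
  have hπ1 := Real.pi_gt_d4
  have hπ2 := Real.pi_lt_d4
  have ha : (-4 : ℝ) < -2.5 := by norm_num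
  have hb₁ : (-4 : ℝ) < -0.075 := by norm_num
  have hb₂ : (-0.075 : ℝ) < 0 := by norm_num
  have hsq := Real.sqrt_pos.2 (klfs_levelProduct_pos hb₁ hb₂)
  refine ⟨?_, ?_, ?_, ?_, ?_, ?_⟩
  · rw [klfs_cHmin_eq ha]; norm_num
  · refine le_trans ?_ (klfs_cQ_ge hb₁ hb₂)
    rw [le_div_iff₀ (by positivity)]
    nlinarith
  · refine (klfs_cU1_le hb₁ hb₂).trans ?_
    rw [div_le_iff₀ hsq]
    nlinarith
  · refine (klfs_cSmax_le hb₁ hb₂).trans ?_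
    have : 4 * π / Real.sqrt (-(-0.075 : ℝ) * (4 + (-0.075))) ≤ 23.17 := by
      rw [div_le_iff₀ hsq]; nlinarith
    linarith
  · refine le_trans ?_ (klfs_cRhomin_ge hb₁ hb₂)
    rw [le_div_iff₀ (by positivity)]
    nlinarith [mul_le_mul hs1 h41 (by norm_num) (Real.sqrt_nonneg _)]
  · refine le_trans ?_ (klfs_cDtmin_ge hb₁ hb₂)
    rw [le_div_iff₀ (by positivity)]
    nlinarith [mul_le_mul hs1 h41 (by norm_num) (Real.sqrt_nonneg _)]

end Summit.HubbardSuperconductivity.HubbardSuperconductivity.Theorems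

end
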